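import Mathlib
import HarnessLib
import Summits.QuantumAdvantage.QuantumAdvantage.Theorems.DigitDialC
import Summits.QuantumAdvantage.QuantumAdvantage.Theorems.DigitDialD

set_option linter.dupNamespace false
set_option autoImplicit false

/-!
# DigitDial (E) — YOUNG-SYMMETRIC low-degree `𝔽_p`-strategies lose the odd-prime u-walk game (cell decomp-qadv, lens 4, g20 rev 2)

Prop-definition-free tree twin of §7c–§7d of the lens-4 g20 node `DigitDial`.
* `wtOn`, `fill`, `symmOn_periodic` — WINDOW-LUCAS periodicity: `P ∈ lowDeg 𝔽_p n d`, `d < p^K`, symmetric on a window `W`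
  depends on the window only through its weight mod `p^K` (reduction to `DigitDialC.symm_lowDeg_periodic` by substitution);
* `hybrid`, `blockSymm_eq`, `blockSymm_factor` — a function symmetric under the Young subgroup of a partition into pairwise
  disjoint covering blocks, of `𝔽_p`-degree `< p^K`, IS a strategy reading the block-indicator forms mod `p^K`;
* `youngSymmetric_card_win_le` — for every prime `p ≠ 3` and `C`, for `n ≥ max 16 2^p`: every strategy whose output bits are
  symmetric on each of `B ≤ (log₂ n)^C` disjoint covering blocks of size `≥ (log₂ n)^{4C+6}` and have `𝔽_p`-degree
  `≤ (log₂ n)^C` wins the u-walk game (any charge) on `≤ (7/8)·2ⁿ` inputs (`DigitDialD.card_win_linStrat_le` +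
  `blockForm_dist` + `pow_twist_small`).  `B = 1` is `DigitDialC.symmetric_card_win_le`; the ceiling of the method is
  `B ≈ √n/polylog` (the `√n` wall of 23109); rev 3: finite form `youngSymmetric_card_win_le_fin` (`n ≥ 4`, `d < p^K`,
  blocks `≥ s ≥ 4p^{2K}(Bp^K+4)`).
0 sorry; axioms standard; no `instance`, no `notation`, no `native_decide`; no `def … : Prop`.
-/

noncomputable section

namespace Summit.QuantumAdvantage.QuantumAdvantage.Theorems.DigitDial

open Finset Summit.QuantumAdvantage.AdviceFreeQNC0 Literature.Computability.MetaComplexity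
open TwistedTransfer ConstBells

/-! ### Window-Lucas periodicity and block-symmetric factorisation -/

section Young

open Smolensky

variable {n : ℕ}

/-- The weight of `u` on the window `W`. -/
def wtOn (W : Finset (Fin n)) (u : Fin n → Bool) : ℕ := (W.filter fun i => u i = true).card

/-- Filling the window `W` with the bits `x ∈ {0,1}^{|W|}` (through `W.equivFin`), the other coordinates from `z`. -/
def fill (W : Finset (Fin n)) (z : Fin n → Bool) (x : Fin W.card → Bool) : Fin n → Bool :=
  fun i => if h : i ∈ W then x (W.equivFin ⟨i, h⟩) else z i

/-- `fill` on a window coordinate. [bookkeeping] -/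
theorem fill_of_mem (W : Finset (Fin n)) (z : Fin n → Bool) (x : Fin W.card → Bool) {i : Fin n} (h : i ∈ W) :
    fill W z x i = x (W.equivFin ⟨i, h⟩) := by
  unfold fill; rw [dif_pos h]

/-- `fill` off the window. [bookkeeping] -/
theorem fill_of_not_mem (W : Finset (Fin n)) (z : Fin n → Bool) (x : Fin W.card → Bool) {i : Fin n} (h : i ∉ W) :
    fill W z x i = z i := by
  unfold fill; rw [dif_neg h]

/-- `fill` is a substitution of variables (each coordinate is a variable or a constant). [bookkeeping] -/
theorem fill_subst (W : Finset (Fin n)) (z : Fin n → Bool) :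
    ∀ i : Fin n, (∃ b, ∀ x, fill W z x i = b) ∨ (∃ j, ∀ x, fill W z x i = x j) := by
  intro i
  by_cases h : i ∈ W
  · exact Or.inr ⟨W.equivFin ⟨i, h⟩, fun x => fill_of_mem W z x h⟩
  · exact Or.inl ⟨z i, fun x => fill_of_not_mem W z x h⟩

/-- The window weight as a sum. [bookkeeping] -/
theorem wtOn_eq_sum (W : Finset (Fin n)) (u : Fin n → Bool) : wtOn W u = ∑ i ∈ W, if u i then 1 else 0 := by
  unfold wtOn
  rw [Finset.card_filter]

/-- The weight of the filling bits is the window weight of the filled input. [bookkeeping] -/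
theorem wtOn_fill (W : Finset (Fin n)) (z : Fin n → Bool) (x : Fin W.card → Bool) : wtOn W (fill W z x) = wt x := by
  rw [wtOn_eq_sum, wt_eq_sum, ← Finset.sum_coe_sort W]
  rw [← Equiv.sum_comp W.equivFin.symm (fun i : W => if fill W z x (i : Fin n) then 1 else 0)]
  refine Finset.sum_congr rfl fun j _ => ?_
  rw [fill_of_mem W z x (W.equivFin.symm j).2]
  simp

/-- Restricting an input to the window (in the `Fin |W|` coordinates). -/
def restrictW (W : Finset (Fin n)) (u : Fin n → Bool) : Fin W.card → Bool := fun j => u (W.equivFin.symm j)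

/-- Refilling the window of `u` with its own bits gives `u`. [bookkeeping] -/
theorem fill_restrictW_self (W : Finset (Fin n)) (u : Fin n → Bool) : fill W u (restrictW W u) = u := by
  funext i
  by_cases h : i ∈ W
  · rw [fill_of_mem W u _ h]; unfold restrictW; simp
  · rw [fill_of_not_mem W u _ h]

/-- Refilling the window of `u` with the bits of `v`, which agrees with `u` off the window, gives `v`. [bookkeeping] -/
theorem fill_restrictW_of_agree (W : Finset (Fin n)) {u v : Fin n → Bool} (hout : ∀ i, i ∉ W → u i = v i) :
    fill W u (restrictW W v) = v := by
  funext i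
  by_cases h : i ∈ W
  · rw [fill_of_mem W u _ h]; unfold restrictW; simp
  · rw [fill_of_not_mem W u _ h, hout i h]

/-- **Window-Lucas periodicity**: if `P ∈ lowDeg 𝔽_p n d` with `d < p^K` is SYMMETRIC ON THE WINDOW `W` (invariant under
changes inside `W` that keep the window weight), then `P` depends on the window only through its weight mod `p^K`. -/
theorem symmOn_periodic {p : ℕ} [Fact p.Prime] {d K : ℕ} (hd : d < p ^ K) (W : Finset (Fin n))
    {P : CubeFn (ZMod p) n} (hP : P ∈ lowDeg (ZMod p) n d)
    (hsymm : ∀ u v : Fin n → Bool, (∀ i, i ∉ W → u i = v i) → wtOn W u = wtOn W v → P u = P v)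
    (u v : Fin n → Bool) (hout : ∀ i, i ∉ W → u i = v i) (hmod : wtOn W u % p ^ K = wtOn W v % p ^ K) :
    P u = P v := by
  set P' : CubeFn (ZMod p) W.card := fun x => P (fill W u x) with hP'def
  have hP' : P' ∈ lowDeg (ZMod p) W.card d := comp_subst_mem_lowDeg (fill W u) (fill_subst W u) hP
  have hsymm' : ∀ x x' : Fin W.card → Bool, wt x = wt x' → P' x = P' x' := fun x x' h =>
    hsymm _ _ (fun i hi => by rw [fill_of_not_mem W u x hi, fill_of_not_mem W u x' hi])
      (by rw [wtOn_fill, wtOn_fill, h])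
  have key := symm_lowDeg_periodic hd hP' hsymm' (restrictW W u) (restrictW W v)
    (by rw [← wtOn_fill W u (restrictW W u), ← wtOn_fill W u (restrictW W v), fill_restrictW_self,
      fill_restrictW_of_agree W hout]; exact hmod)
  have h1 : P' (restrictW W u) = P u := by
    show P (fill W u (restrictW W u)) = P u
    rw [fill_restrictW_self]
  have h2 : P' (restrictW W v) = P v := by
    show P (fill W u (restrictW W v)) = P v
    rw [fill_restrictW_of_agree W hout]
  rw [← h1, ← h2]
  exact key

/-- The hybrid inputs: `v` on the blocks `W_b`, `b < k`, and `u` elsewhere. -/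
def hybrid {B : ℕ} (W : Fin B → Finset (Fin n)) (u v : Fin n → Bool) (k : ℕ) : Fin n → Bool :=
  fun i => if ∃ b : Fin B, b.val < k ∧ i ∈ W b then v i else u i

/-- **Block-symmetric functions of low degree see only the block weights mod `p^K`.**  If the blocks `W_b` are pairwise
disjoint and cover the coordinates, `f` is symmetric on every block and `HasDegF p f d` with `d < p^K`, then `f u = f v`
whenever all block weights agree mod `p^K`. -/
theorem blockSymm_eq {p : ℕ} [Fact p.Prime] {d K B : ℕ} (hd : d < p ^ K) (W : Fin B → Finset (Fin n))
    (hdisj : ∀ b b', b ≠ b' → Disjoint (W b) (W b')) (hcover : ∀ i, ∃ b, i ∈ W b)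
    {f : (Fin n → Bool) → Bool}
    (hf : ∀ b, ∀ u v : Fin n → Bool, (∀ i, i ∉ W b → u i = v i) → wtOn (W b) u = wtOn (W b) v → f u = f v)
    (hdeg : HasDegF p f d) (u v : Fin n → Bool) (huv : ∀ b, wtOn (W b) u % p ^ K = wtOn (W b) v % p ^ K) :
    f u = f v := by
  classical
  -- one block at a time, through the indicator polynomial
  have hone : ∀ b, ∀ u v : Fin n → Bool, (∀ i, i ∉ W b → u i = v i) →
      wtOn (W b) u % p ^ K = wtOn (W b) v % p ^ K → f u = f v := by
    intro b u v hout hmod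
    have key := symmOn_periodic hd (W b) hdeg
      (fun u v h1 h2 => by simp only [hf b u v h1 h2]) u v hout hmod
    by_cases hfu : f u = true <;> by_cases hfv : f v = true <;> simp_all
  -- hybrids
  have hz0 : hybrid W u v 0 = u := by
    funext i; unfold hybrid; rw [if_neg]; rintro ⟨b, hb, _⟩; exact Nat.not_lt_zero _ hb
  have hzB : hybrid W u v B = v := by
    funext i; obtain ⟨b, hb⟩ := hcover i; unfold hybrid; rw [if_pos ⟨b, b.isLt, hb⟩]
  have hstep : ∀ k, k < B → f (hybrid W u v (k + 1)) = f (hybrid W u v k) := by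
    intro k hk
    set b : Fin B := ⟨k, hk⟩ with hb
    refine (hone b _ _ (fun i hi => ?_) ?_).symm
    · -- outside `W_b` the hybrids `k` and `k+1` agree
      unfold hybrid
      by_cases h : ∃ b' : Fin B, b'.val < k ∧ i ∈ W b'
      · obtain ⟨b', hb', hi'⟩ := h
        rw [if_pos ⟨b', hb', hi'⟩, if_pos ⟨b', Nat.lt_succ_of_lt hb', hi'⟩]
      · rw [if_neg h, if_neg]
        rintro ⟨b', hb', hi'⟩
        rcases Nat.lt_succ_iff_lt_or_eq.1 hb' with hlt | heq
        · exact h ⟨b', hlt, hi'⟩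
        · have : b' = b := Fin.ext (by rw [hb]; exact heq)
          exact hi (this ▸ hi')
    · -- on `W_b`: hybrid `k` is `u`, hybrid `k+1` is `v`
      have h1 : wtOn (W b) (hybrid W u v k) = wtOn (W b) u := by
        unfold wtOn
        congr 1
        refine Finset.filter_congr fun i hi => ?_
        unfold hybrid
        rw [if_neg]
        rintro ⟨b', hb', hi'⟩
        have hne : b' ≠ b := by
          intro h; rw [h, hb] at hb'; exact lt_irrefl k hb'
        exact Finset.disjoint_left.1 (hdisj b' b hne) hi' hi
      have h2 : wtOn (W b) (hybrid W u v (k + 1)) = wtOn (W b) v := by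
        unfold wtOn
        congr 1
        refine Finset.filter_congr fun i hi => ?_
        unfold hybrid
        rw [if_pos ⟨b, by rw [hb]; exact Nat.lt_succ_self k, hi⟩]
      rw [h1, h2]
      exact huv b
  have hind : ∀ k, k ≤ B → f (hybrid W u v k) = f u := by
    intro k
    induction k with
    | zero => intro _; rw [hz0]
    | succ k ih => intro hk; rw [hstep k (by omega), ih (by omega)]
  rw [← hind B le_rfl, hzB]

/-- The block weight mod `M` is the value of the block form. [bookkeeping] -/
theorem linVal_blockForm_val (M : ℕ) [NeZero M] {B : ℕ} (W : Fin B → Finset (Fin n)) (u : Fin n → Bool) (b : Fin B) :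
    (linVal (blockForm M W) u b).val = wtOn (W b) u % M := by
  unfold linVal blockForm wtOn
  have : (∑ i : Fin n, if u i then (if i ∈ W b then (1 : ZMod M) else 0) else 0) =
      ∑ i : Fin n, if (i ∈ W b ∧ u i = true) then (1 : ZMod M) else 0 := by
    refine Finset.sum_congr rfl fun i _ => ?_
    by_cases h1 : u i = true <;> by_cases h2 : i ∈ W b <;> simp [h1, h2]
  rw [this, Finset.sum_boole, ZMod.val_natCast]
  congr 2
  ext i
  simp [Finset.mem_filter]

/-- **`blockSymm_factor`** — a block-symmetric Boolean function of `𝔽_p`-degree `d < p^K` (blocks pairwise disjoint and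
covering) IS a strategy reading the `B` block forms mod `p^K`. -/
theorem blockSymm_factor {p : ℕ} [hp : Fact p.Prime] {d K B : ℕ} (hd : d < p ^ K) (W : Fin B → Finset (Fin n))
    (hdisj : ∀ b b', b ≠ b' → Disjoint (W b) (W b')) (hcover : ∀ i, ∃ b, i ∈ W b)
    {f : (Fin n → Bool) → Bool}
    (hf : ∀ b, ∀ u v : Fin n → Bool, (∀ i, i ∉ W b → u i = v i) → wtOn (W b) u = wtOn (W b) v → f u = f v)
    (hdeg : HasDegF p f d) :
    ∃ tab : (Fin B → ZMod (p ^ K)) → Bool, ∀ u, f u = tab (linVal (blockForm (p ^ K) W) u) := by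
  classical
  haveI : NeZero (p ^ K) := ⟨pow_ne_zero _ hp.out.ne_zero⟩
  refine ⟨fun r => if h : ∃ u, linVal (blockForm (p ^ K) W) u = r then f h.choose else false, fun u => ?_⟩
  have hex : ∃ u', linVal (blockForm (p ^ K) W) u' = linVal (blockForm (p ^ K) W) u := ⟨u, rfl⟩
  show f u = (if h : ∃ u', linVal (blockForm (p ^ K) W) u' = linVal (blockForm (p ^ K) W) u then f h.choose else false)
  rw [dif_pos hex]
  refine blockSymm_eq hd W hdisj hcover hf hdeg u hex.choose fun b => ?_
  rw [← linVal_blockForm_val, ← linVal_blockForm_val, hex.choose_spec]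

/-- **Young-symmetric low-degree strategies lose** (the Young-subgroup extension of `symmetric_card_win_le`): for every
prime `p ≠ 3` and every `C`, for `n ≥ max 16 2^p`, every charge, every partition of the coordinates into `B ≤ (log₂ n)^C`
pairwise disjoint blocks of size `≥ (log₂ n)^{4C+6}`, every strategy all of whose output bits are symmetric on every block
and of `𝔽_p`-degree `≤ (log₂ n)^C` wins the u-walk game on at most `(7/8)·2ⁿ` inputs. -/
theorem youngSymmetric_card_win_le (p : ℕ) [hp : Fact p.Prime] (hp3 : p ≠ 3) (C : ℕ) :
    ∀ n ≥ max 16 (2 ^ p), ∀ c : ℕ, ∀ (B : ℕ) (W : Fin B → Finset (Fin n)),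
    B ≤ (Nat.log 2 n) ^ C → (∀ b b', b ≠ b' → Disjoint (W b) (W b')) → (∀ i, ∃ b, i ∈ W b) →
    (∀ b, (Nat.log 2 n) ^ (4 * C + 6) ≤ (W b).card) →
    ∀ y : Fin (n + 1) → (Fin n → Bool) → Bool,
      (∀ g b, ∀ u v : Fin n → Bool, (∀ i, i ∉ W b → u i = v i) → wtOn (W b) u = wtOn (W b) v → y g u = y g v) →
      (∀ g, HasDegF p (y g) ((Nat.log 2 n) ^ C)) →
        ((univ.filter fun u : Fin n → Bool => ringWinU c y u = true).card : ℝ) ≤ (7 / 8) * (2 : ℝ) ^ n := by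
  intro n hn c B W hB hdisj hcover hsize y hys hyd
  have hn16 : 16 ≤ n := le_trans (le_max_left _ _) hn
  have hn2 : 2 ^ p ≤ n := le_trans (le_max_right _ _) hn
  have hp2 : 2 ≤ p := hp.out.two_le
  set L : ℕ := Nat.log 2 n with hLdef
  have hL4 : 4 ≤ L := Nat.le_log_of_pow_le (by norm_num) (show 2 ^ 4 ≤ n by norm_num; exact hn16)
  have hLp : p ≤ L := Nat.le_log_of_pow_le (by norm_num) hn2
  set d : ℕ := L ^ C with hd
  have hd1 : 1 ≤ d := Nat.one_le_pow _ _ (by omega)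
  set K : ℕ := Nat.log p d + 1 with hK
  have hdK : d < p ^ K := Nat.lt_pow_succ_log_self hp.out.one_lt d
  have hKle : p ^ K ≤ L ^ (C + 1) := by
    rw [hK, pow_succ, pow_succ]
    exact Nat.mul_le_mul (Nat.pow_log_le_self p (by omega)) hLp
  haveI : NeZero (p ^ K) := ⟨pow_ne_zero _ hp.out.ne_zero⟩
  have hcop : (p ^ K).Coprime 3 :=
    Nat.Coprime.pow_left _ ((Nat.coprime_primes hp.out Nat.prime_three).2 hp3)
  -- every output bit reads the block forms mod `p^K`
  choose tab htab using fun g => blockSymm_factor hdK W hdisj hcover (hys g) (hyd g)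
  have hy : y = linStrat (blockForm (p ^ K) W) tab := by
    funext g u
    exact htab g u
  rw [hy]
  have hmain := card_win_linStrat_le hcop (by omega) c (blockForm (p ^ K) W)
    (fun γ hγ => blockForm_dist W hdisj hsize γ hγ) tab
  have hsmall : 3 * ((p ^ K : ℕ) : ℝ) ^ B * Real.cos (Real.pi / (3 * (p ^ K : ℕ))) ^ (L ^ (4 * C + 6)) ≤ 1 / 8 :=
    pow_twist_small (p ^ K) B (L ^ (4 * C + 6)) (Nat.one_le_pow _ _ hp.out.pos)
      (block_hyp hL4 hKle hB le_rfl)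
  have h2n : (0 : ℝ) ≤ (2 : ℝ) ^ n := by positivity
  nlinarith

end Young


/-! ### Finite form (rev 3) -/

section FiniteFormsE

variable {n : ℕ}

/-- **Finite form of the Young-symmetric bound**: prime `p ≠ 3`, `n ≥ 4`, degree `d < p^K`, `B` pairwise disjoint covering
blocks each of size `≥ s ≥ 4p^{2K}(B·p^K + 4)`: every block-symmetric strategy of `𝔽_p`-degree `≤ d` wins on `≤ (7/8)·2ⁿ`
(no polylogarithmic bookkeeping; e.g. `d` up to `≈ (n/B)^{1/3}/p` is allowed). -/
theorem youngSymmetric_card_win_le_fin {p : ℕ} [hp : Fact p.Prime] (hp3 : p ≠ 3) {d K B : ℕ} (hn : 4 ≤ n)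
    (hd : d < p ^ K) (W : Fin B → Finset (Fin n)) (hdisj : ∀ b b', b ≠ b' → Disjoint (W b) (W b'))
    (hcover : ∀ i, ∃ b, i ∈ W b) {s : ℕ} (hsize : ∀ b, s ≤ (W b).card) (hs : 4 * (p ^ K) ^ 2 * (B * p ^ K + 4) ≤ s)
    (c : ℕ) (y : Fin (n + 1) → (Fin n → Bool) → Bool)
    (hys : ∀ g b, ∀ u v : Fin n → Bool, (∀ i, i ∉ W b → u i = v i) → wtOn (W b) u = wtOn (W b) v → y g u = y g v)
    (hyd : ∀ g, HasDegF p (y g) d) :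
    ((univ.filter fun u : Fin n → Bool => ringWinU c y u = true).card : ℝ) ≤ (7 / 8) * (2 : ℝ) ^ n := by
  haveI : NeZero (p ^ K) := ⟨pow_ne_zero _ hp.out.ne_zero⟩
  have hcop : (p ^ K).Coprime 3 :=
    Nat.Coprime.pow_left _ ((Nat.coprime_primes hp.out Nat.prime_three).2 hp3)
  choose tab htab using fun g => blockSymm_factor hd W hdisj hcover (hys g) (hyd g)
  have hy : y = linStrat (blockForm (p ^ K) W) tab := by
    funext g u
    exact htab g u
  rw [hy]
  exact linStrat_card_win_le_fin hcop hn c (blockForm (p ^ K) W) (fun γ hγ => blockForm_dist W hdisj hsize γ hγ) hs tab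

end FiniteFormsE

end Summit.QuantumAdvantage.QuantumAdvantage.Theorems.DigitDial
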